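import Literature.Barriers.ValiantsHypothesis.MonotoneGapDecomposition

/-!
# Route `FreeEnergyLift`, item `MonotoneToLift` (stmt-ValiantsHypothesis-5606) — part 1/3:
# the cone program of a monotone circuit

Plumbing for `monotoneToLift_proof` (part 3, `FreeEnergyLiftMonotoneToLift.lean`): the positive
valuation `val u : g ↦ g(e^u)` of polynomials over `ℝ≥0` (a ring hom, vanishing only at `g = 0`),
the exponential cone `expCone` in the route's inlined form, affine forms `AF` on the lift space
`((u, t), y)` packaged as data with a linear part `AF.lin`, the gate values `V` / operand values
`opVal` of a straight-line circuit (via `getD_gateValues` of `MonotoneGapDecomposition.lean`), and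
the cone program (`slot`, `Amap`, `bvec`; `3 · size + 1` constraints, `3 · size` auxiliary
variables `T_w = y_{3w}`, `Z_{w,i} = y_{3w+i}`) together with the canonical feasible point `ystar`.
See part 3 for the mathematical description. All definitions here are proof-internal plumbing.
HONEST FRAMING: bookkeeping for a dormant route's dictionary item; nothing here bears on
`VP ≠ VNP`, which is NOT proved.
-/

noncomputable section

open MvPolynomial
open scoped NNReal

-- layout Summits/ValiantsHypothesis/ValiantsHypothesis forces the duplicated namespace component
set_option linter.dupNamespace false

namespace Summit.ValiantsHypothesis.ValiantsHypothesis.Theorems.FreeEnergyLift.MonotoneLift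

open Literature.Computability.AlgebraicComplexity
open Literature.Barriers.ValiantsHypothesis
open ArithCircuit

section Valuation

variable {σ : Type}

/-- The real valuation `g ↦ g(e^{u})` of polynomials with nonnegative real coefficients at the
positive point `(e^{u_i})_i`, as a ring homomorphism. [folklore] -/
def val (u : σ → ℝ) : MvPolynomial σ ℝ≥0 →+* ℝ :=
  (eval fun i => Real.exp (u i)).comp (map NNReal.toRealHom)

/-- Unfolding of `val`. [folklore] -/
theorem val_apply (u : σ → ℝ) (g : MvPolynomial σ ℝ≥0) :
    val u g = eval (fun i => Real.exp (u i)) (map NNReal.toRealHom g) := rfl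

/-- `val u (X i) = e^{u_i}`. [folklore] -/
@[simp] theorem val_X (u : σ → ℝ) (i : σ) : val u (X i) = Real.exp (u i) := by
  simp [val_apply]

/-- `val u (C c) = c`. [folklore] -/
@[simp] theorem val_C (u : σ → ℝ) (c : ℝ≥0) : val u (C c) = (c : ℝ) := by
  simp [val_apply]

/-- The valuation as a sum of nonnegative terms over the support. [folklore] -/
theorem val_eq_sum (u : σ → ℝ) (g : MvPolynomial σ ℝ≥0) :
    val u g = ∑ d ∈ g.support, ((coeff d g : ℝ≥0) : ℝ) *
      ∏ i ∈ d.support, Real.exp (u i) ^ (d i) := by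
  rw [val_apply, MvPolynomial.eval_map, eval₂_eq]
  rfl

/-- Each term of the valuation is positive on the support. [folklore] -/
theorem val_term_pos (u : σ → ℝ) (g : MvPolynomial σ ℝ≥0) {d : σ →₀ ℕ} (hd : d ∈ g.support) :
    0 < ((coeff d g : ℝ≥0) : ℝ) * ∏ i ∈ d.support, Real.exp (u i) ^ (d i) := by
  refine mul_pos ?_ (Finset.prod_pos fun i _ => pow_pos (Real.exp_pos _) _)
  have h : coeff d g ≠ 0 := mem_support_iff.mp hd
  exact_mod_cast pos_iff_ne_zero.mpr h

/-- The valuation is nonnegative. [folklore] -/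
theorem val_nonneg (u : σ → ℝ) (g : MvPolynomial σ ℝ≥0) : 0 ≤ val u g := by
  rw [val_eq_sum]
  exact Finset.sum_nonneg fun d hd => (val_term_pos u g hd).le

/-- The valuation vanishes only on the zero polynomial (no cancellation over `ℝ≥0`).
[folklore] -/
theorem val_eq_zero_iff (u : σ → ℝ) (g : MvPolynomial σ ℝ≥0) : val u g = 0 ↔ g = 0 := by
  constructor
  · intro h
    rw [val_eq_sum, Finset.sum_eq_zero_iff_of_nonneg (fun d hd => (val_term_pos u g hd).le)] at h
    by_contra hg
    obtain ⟨d, hd⟩ := Finset.nonempty_iff_ne_empty.mpr (support_eq_empty.not.mpr hg)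
    exact (val_term_pos u g hd).ne' (h d hd)
  · rintro rfl; simp

/-- The valuation of a nonzero polynomial is positive. [folklore] -/
theorem val_pos (u : σ → ℝ) {g : MvPolynomial σ ℝ≥0} (hg : g ≠ 0) : 0 < val u g :=
  lt_of_le_of_ne (val_nonneg u g) (fun h => hg ((val_eq_zero_iff u g).mp h.symm))

end Valuation

section Cone

/-- The (closed) exponential cone in the inlined form of the route: `{(w₁,w₂,w₃) | w₂ > 0 ∧
w₂ e^{w₁/w₂} ≤ w₃} ∪ {w₂ = 0, w₁ ≤ 0, 0 ≤ w₃}`. [folklore] -/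
def expCone : Set (ℝ × ℝ × ℝ) :=
  {w : ℝ × ℝ × ℝ | (0 < w.2.1 ∧ w.2.1 * Real.exp (w.1 / w.2.1) ≤ w.2.2) ∨
    (w.2.1 = 0 ∧ w.1 ≤ 0 ∧ 0 ≤ w.2.2)}

/-- A degenerate triple `(a, 0, c)` is in the cone iff `a ≤ 0 ≤ c`. [folklore] -/
theorem mem_expCone_zero (a c : ℝ) : ((a, (0 : ℝ), c) : ℝ × ℝ × ℝ) ∈ expCone ↔ a ≤ 0 ∧ 0 ≤ c := by
  simp [expCone]

/-- A normalised triple `(a, 1, c)` is in the cone iff `e^a ≤ c`. [folklore] -/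
theorem mem_expCone_one (a c : ℝ) : ((a, (1 : ℝ), c) : ℝ × ℝ × ℝ) ∈ expCone ↔ Real.exp a ≤ c := by
  simp [expCone]

end Cone

section Affine

variable (σ : Type) [Fintype σ] (p : ℕ)

/-- The ambient space of the lift: `((u, t), y)` with `u ∈ ℝ^σ`, `t ∈ ℝ`, `y ∈ ℝ^p`. [folklore] -/
abbrev Sp : Type := ((σ → ℝ) × ℝ) × (Fin p → ℝ)

/-- An affine form `Σ cu_i u_i + ct·t + Σ cy_j y_j + c0` on the lift space, as data. [folklore] -/
structure AF where
  /-- coefficients of the `u`-variables -/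
  cu : σ → ℝ
  /-- coefficient of `t` -/
  ct : ℝ
  /-- coefficients of the auxiliary variables `y` -/
  cy : Fin p → ℝ
  /-- constant term -/
  c0 : ℝ

variable {σ p}

namespace AF

/-- The linear part of an affine form, as a linear map. [folklore] -/
def lin (a : AF σ p) : Sp σ p →ₗ[ℝ] ℝ :=
  (∑ i, a.cu i • ((LinearMap.proj i).comp ((LinearMap.fst ℝ _ _).comp (LinearMap.fst ℝ _ _)))) +
    a.ct • ((LinearMap.snd ℝ _ _).comp (LinearMap.fst ℝ _ _)) +
    ∑ j, a.cy j • ((LinearMap.proj j).comp (LinearMap.snd ℝ _ _))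

/-- The linear part, evaluated. [folklore] -/
theorem lin_apply (a : AF σ p) (v : Sp σ p) :
    a.lin v = (∑ i, a.cu i * v.1.1 i) + a.ct * v.1.2 + ∑ j, a.cy j * v.2 j := by
  simp [lin, LinearMap.sum_apply]

/-- The value of an affine form. [folklore] -/
def ev (a : AF σ p) (v : Sp σ p) : ℝ := a.lin v + a.c0

/-- The value of an affine form, expanded. [folklore] -/
theorem ev_eq (a : AF σ p) (v : Sp σ p) :
    a.ev v = (∑ i, a.cu i * v.1.1 i) + a.ct * v.1.2 + (∑ j, a.cy j * v.2 j) + a.c0 := by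
  rw [ev, lin_apply]

/-- The zero form. [folklore] -/
def zero : AF σ p := ⟨fun _ => 0, 0, fun _ => 0, 0⟩

/-- Sum of affine forms. [folklore] -/
def add (a b : AF σ p) : AF σ p := ⟨fun i => a.cu i + b.cu i, a.ct + b.ct, fun j => a.cy j + b.cy j, a.c0 + b.c0⟩

/-- Difference of affine forms. [folklore] -/
def sub (a b : AF σ p) : AF σ p := ⟨fun i => a.cu i - b.cu i, a.ct - b.ct, fun j => a.cy j - b.cy j, a.c0 - b.c0⟩

/-- The constant form. [folklore] -/
def const (c : ℝ) : AF σ p := ⟨fun _ => 0, 0, fun _ => 0, c⟩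

/-- The coordinate form `t`. [folklore] -/
def tF : AF σ p := ⟨fun _ => 0, 1, fun _ => 0, 0⟩

/-- The coordinate form `u_i`. [folklore] -/
def uF (i : σ) : AF σ p := by
  classical exact ⟨fun i' => if i' = i then 1 else 0, 0, fun _ => 0, 0⟩

/-- The coordinate form `y_n` for a natural index `n` (the zero form if `n ≥ p`). [folklore] -/
def yF (n : ℕ) : AF σ p := ⟨fun _ => 0, 0, fun j => if (j : ℕ) = n then 1 else 0, 0⟩

/-- The `n`-th auxiliary coordinate of a point, `0` beyond the range. [folklore] -/
def Y (y : Fin p → ℝ) (n : ℕ) : ℝ := if h : n < p then y ⟨n, h⟩ else 0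

/-- Value of the zero form. [folklore] -/
@[simp] theorem ev_zero (v : Sp σ p) : (zero : AF σ p).ev v = 0 := by simp [ev_eq, zero]

/-- Value of a sum of forms. [folklore] -/
@[simp] theorem ev_add (a b : AF σ p) (v : Sp σ p) : (a.add b).ev v = a.ev v + b.ev v := by
  simp only [ev_eq, add, add_mul, Finset.sum_add_distrib]; ring

/-- Value of a difference of forms. [folklore] -/
@[simp] theorem ev_sub (a b : AF σ p) (v : Sp σ p) : (a.sub b).ev v = a.ev v - b.ev v := by
  simp only [ev_eq, sub, sub_mul, Finset.sum_sub_distrib]; ring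

/-- Value of a constant form. [folklore] -/
@[simp] theorem ev_const (c : ℝ) (v : Sp σ p) : (const c : AF σ p).ev v = c := by
  simp [ev_eq, const]

/-- Value of the form `t`. [folklore] -/
@[simp] theorem ev_tF (v : Sp σ p) : (tF : AF σ p).ev v = v.1.2 := by simp [ev_eq, tF]

/-- Value of the form `u_i`. [folklore] -/
@[simp] theorem ev_uF (i : σ) (v : Sp σ p) : (uF i : AF σ p).ev v = v.1.1 i := by
  classical
  simp [ev_eq, uF, Finset.sum_ite_eq']

/-- Value of the form `y_n`. [folklore] -/
@[simp] theorem ev_yF (n : ℕ) (v : Sp σ p) : (yF n : AF σ p).ev v = Y v.2 n := by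
  simp only [ev_eq, yF, zero_mul, Finset.sum_const_zero, zero_add, add_zero, ite_mul, one_mul,
    Y]
  by_cases h : n < p
  · rw [dif_pos h, Finset.sum_eq_single ⟨n, h⟩]
    · simp
    · intro b _ hb
      rw [if_neg]
      exact fun e => hb (Fin.ext e)
    · simp
  · rw [dif_neg h]
    refine Finset.sum_eq_zero fun x _ => ?_
    rw [if_neg]
    intro e
    exact h (e ▸ x.2)

end AF

end Affine

namespace AF

variable {σ : Type} [Fintype σ] {p : ℕ}

/-- Sum of a list of affine forms. [folklore] -/
def lsum : List (AF σ p) → AF σ p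
  | [] => zero
  | a :: l => a.add (lsum l)

/-- Value of an empty sum of forms. [folklore] -/
@[simp] theorem ev_lsum_nil (v : Sp σ p) : (lsum ([] : List (AF σ p))).ev v = 0 := ev_zero v

/-- Value of a sum of forms, cons step. [folklore] -/
@[simp] theorem ev_lsum_cons (a : AF σ p) (l : List (AF σ p)) (v : Sp σ p) :
    (lsum (a :: l)).ev v = a.ev v + (lsum l).ev v := ev_add a _ v

/-- `Y` at an in-range index. [folklore] -/
theorem Y_of_lt (y : Fin p → ℝ) {n : ℕ} (h : n < p) : Y y n = y ⟨n, h⟩ := dif_pos h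

end AF

section Values

variable {σ : Type} (P : ArithCircuit ℝ≥0 σ)

/-- The value of gate `j` (junk `0` out of range). [folklore] -/
def V (j : ℕ) : MvPolynomial σ ℝ≥0 := (gateValues P.gates).getD j 0

/-- The value of an operand read inside gate `w` (gate references `≥ w` are junk `0`). [folklore] -/
def opVal (w : ℕ) (o : Operand ℝ≥0 σ) : MvPolynomial σ ℝ≥0 :=
  o.eval ((gateValues P.gates).take w)

/-- A gate reference reads an earlier gate value or junk `0`. [folklore] -/
theorem opVal_gate (w j : ℕ) : opVal P w (.gate j) = if j < w then V P j else 0 := by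
  simp only [opVal, Operand.eval, V]
  exact getD_take_gateValues P.gates w j

/-- The value of a gate is its evaluation against the earlier values. [folklore] -/
theorem V_eq_eval {w : ℕ} {g : Gate ℝ≥0 σ} (hg : P.gates[w]? = some g) :
    V P w = g.eval ((gateValues P.gates).take w) := by
  simp only [V]
  exact getD_gateValues hg

/-- The value of a product gate. [folklore] -/
theorem V_prod {w : ℕ} {os : List (Operand ℝ≥0 σ)} (hg : P.gates[w]? = some (.prod os)) :
    V P w = (os.map (opVal P w)).prod := by
  rw [V_eq_eval P hg]; rfl

/-- The value of a plain sum gate. [folklore] -/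
theorem V_sum {w : ℕ} {args : List (ℝ≥0 × Operand ℝ≥0 σ)} (hplain : IsPlain P)
    (hg : P.gates[w]? = some (.sum args)) :
    V P w = (args.map fun a => opVal P w a.2).sum := by
  rw [V_eq_eval P hg]
  simp only [Gate.eval, opVal]
  congr 1
  refine List.map_congr_left fun a ha => ?_
  have h1 : a.1 = 1 := (isPlainGate_sum_iff args).mp (hplain _ (List.mem_of_getElem? hg)) a ha
  rw [h1, one_smul]

/-- The output is the output operand read after all gates. [folklore] -/
theorem eval_eq_opVal : P.eval = opVal P P.size P.output := by
  simp only [ArithCircuit.eval, opVal, ArithCircuit.size]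
  rw [List.take_of_length_le (by rw [gateValues_length])]

end Values

section Program

variable {σ : Type} [Fintype σ] (P : ArithCircuit ℝ≥0 σ) (p : ℕ)

/-- The affine "log-value" form of an operand: `u_i` for `X i`, `log c` for the constant `c`,
the auxiliary coordinate `y_{3j}` (log of the value of gate `j`) for a gate reference. [folklore] -/
def LOp : Operand ℝ≥0 σ → AF σ p
  | .var i => AF.uF i
  | .const c => AF.const (Real.log c)
  | .gate j => AF.yF (3 * j)

/-- A cone constraint: affine first coordinate, constant second coordinate, affine third
coordinate. [folklore] -/
abbrev Slot (σ : Type) [Fintype σ] (p : ℕ) : Type := AF σ p × ℝ × AF σ p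

/-- The trivially satisfied constraint `(0, 0, 0)`. [folklore] -/
def triv : Slot σ p := (AF.zero, 0, AF.zero)

/-- The triple of values of a constraint at a point (its membership in `expCone` is the
satisfaction of the constraint). [folklore] -/
def slotPt (S : Slot σ p) (v : Sp σ p) : ℝ × ℝ × ℝ := (S.1.ev v, S.2.1, S.2.2.ev v)

open Classical in
/-- The `i`-th operand constraint (`i = 0, 1`) of the sum gate `w` with arguments `args`:
`(L(oᵢ) - y_{3w}, 1, y_{3w+1+i})` ("`e^{L(oᵢ) - T_w} ≤ Zᵢ`") if the operand exists and is nonzero,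
else `(0, 0, y_{3w+1+i})` ("`0 ≤ Zᵢ`"). [folklore] -/
def sumSlot (w : ℕ) (args : List (ℝ≥0 × Operand ℝ≥0 σ)) (i : ℕ) : Slot σ p :=
  match (args.map Prod.snd)[i]? with
  | some o => if opVal P w o = 0 then (AF.zero, 0, AF.yF (3 * w + 1 + i))
      else ((LOp p o).sub (AF.yF (3 * w)), 1, AF.yF (3 * w + 1 + i))
  | none => (AF.zero, 0, AF.yF (3 * w + 1 + i))

/-- The three constraints of gate `w` given its gate (before pruning zero gates): a product gate
gets `(Σ L(o) - y_{3w}, 0, 0)` ("`T_w ≥ Σ log-values`"); a sum gate gets the face inequality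
`(y_{3w+1} + y_{3w+2} - 1, 0, 0)` and its two operand constraints. [folklore] -/
def gateSlotsOf (w : ℕ) : Option (Gate ℝ≥0 σ) → Fin 3 → Slot σ p
  | none => fun _ => triv p
  | some (.prod os) => fun r =>
      if (r : ℕ) = 0 then ((AF.lsum (os.map (LOp p))).sub (AF.yF (3 * w)), 0, AF.zero) else triv p
  | some (.sum args) => fun r =>
      if (r : ℕ) = 0 then (((AF.yF (3 * w + 1)).add (AF.yF (3 * w + 2))).sub (AF.const 1), 0, AF.zero)
      else sumSlot P p w args ((r : ℕ) - 1)

open Classical in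
/-- The three constraints of gate `w`: trivial if the gate computes `0`, else `gateSlotsOf`.
[folklore] -/
def gateSlots (w : ℕ) (r : Fin 3) : Slot σ p :=
  if V P w = 0 then triv p else gateSlotsOf P p w (P.gates[w]?) r

open Classical in
/-- The output constraint: `(-t, 0, 0)` if the circuit computes `0` (then `log 0 = 0 ≤ t` is the
epigraph condition), else `(L(out) - t, 0, 0)`. [folklore] -/
def outSlot : Slot σ p :=
  if P.eval = 0 then ((AF.zero).sub AF.tF, 0, AF.zero) else ((LOp p P.output).sub AF.tF, 0, AF.zero)

/-- All constraints, indexed by `Fin (3 · size + 1)`: slot `3w + r` is the `r`-th constraint of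
gate `w`, the last slot is the output constraint. [folklore] -/
def slot (c : Fin (3 * P.size + 1)) : Slot σ p :=
  if (c : ℕ) / 3 < P.size then gateSlots P p ((c : ℕ) / 3) ⟨(c : ℕ) % 3, Nat.mod_lt _ (by norm_num)⟩
  else outSlot P p

/-- The linear part of the cone program. [folklore] -/
def Amap : Sp σ p →ₗ[ℝ] (Fin (3 * P.size + 1) → ℝ × ℝ × ℝ) :=
  LinearMap.pi fun c =>
    ((slot P p c).1.lin).prod ((0 : Sp σ p →ₗ[ℝ] ℝ).prod (slot P p c).2.2.lin)

/-- The constant part of the cone program. [folklore] -/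
def bvec : Fin (3 * P.size + 1) → ℝ × ℝ × ℝ :=
  fun c => ((slot P p c).1.c0, (slot P p c).2.1, (slot P p c).2.2.c0)

/-- The cone program evaluated at a point. [folklore] -/
theorem Amap_add_bvec_apply (v : Sp σ p) (c : Fin (3 * P.size + 1)) :
    (Amap P p v + bvec P p) c = ((slot P p c).1.ev v, (slot P p c).2.1, (slot P p c).2.2.ev v) := by
  simp [Amap, bvec, AF.ev]

/-- Slot `3w + r` is the `r`-th constraint of gate `w`. [folklore] -/
theorem slot_gate {w : ℕ} (hw : w < P.size) (r : Fin 3) :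
    slot P p ⟨3 * w + r, by omega⟩ = gateSlots P p w r := by
  have h1 : (3 * w + (r : ℕ)) / 3 = w := by omega
  have h2 : (3 * w + (r : ℕ)) % 3 = r := by omega
  simp only [slot, h1, hw, if_true]
  congr 1
  exact Fin.ext h2

/-- The last slot is the output constraint. [folklore] -/
theorem slot_out : slot P p ⟨3 * P.size, by omega⟩ = outSlot P p := by
  have h1 : (3 * P.size) / 3 = P.size := by omega
  simp [slot, h1]

end Program

section Canonical

variable {σ : Type} (P : ArithCircuit ℝ≥0 σ)

/-- The canonical value of the auxiliary variable `Z_{w,i}`: the share of operand `i` in the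
value of the sum gate `w` (junk `0` otherwise). [folklore] -/
def Zstar (u : σ → ℝ) (w i : ℕ) : ℝ :=
  match P.gates[w]? with
  | some (.sum args) =>
    match (args.map Prod.snd)[i]? with
    | some o => val u (opVal P w o) / val u (V P w)
    | none => 0
  | _ => 0

/-- The canonical point: `y_{3w} = log V_w(e^u)`, `y_{3w+1+i} = Z_{w,i}`. [folklore] -/
def ystar (u : σ → ℝ) : Fin (3 * P.size) → ℝ := fun j =>
  if (j : ℕ) % 3 = 0 then Real.log (val u (V P ((j : ℕ) / 3)))
  else Zstar P u ((j : ℕ) / 3) ((j : ℕ) % 3 - 1)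

end Canonical

end Summit.ValiantsHypothesis.ValiantsHypothesis.Theorems.FreeEnergyLift.MonotoneLift
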